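import Literature.MathematicalPhysics.QuantumFieldTheory.Balaban1983to89.B9Eq326OperatorTower
import Literature.MathematicalPhysics.QuantumFieldTheory.Balaban1983to89.B9Eq316TowerFlatIsOneStep
import Literature.MathematicalPhysics.QuantumFieldTheory.Balaban1983to89.B9Eq349BlockDecayAlgebra
import Literature.MathematicalPhysics.QuantumFieldTheory.Balaban1983to89.B9Eq349BlockMultipliers
import Literature.MathematicalPhysics.QuantumFieldTheory.Balaban1983to89.B9Eq349ConjugatedGreenLetters

/-!
# `Balaban1983to89.B9Eq3126H1BlockDecayOfLettersTower` — T. Bałaban, *Propagators for lattice gauge theories in a background field*, Commun. Math. Phys. **99**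
# (1985) 389–434 [Balaban1985BackgroundPropagators] (3.15)∕(3.16) p. 393, (3.49) p. 399, (3.126) p. 420, Thm 3.11 p. 416 with [Balaban1985Variational] (45) p. 285,
# (103) p. 293, (110) p. 294 and [Balaban1984PropagatorsI] p. 38: **THE `L²` DECAY OF `H₁,k(U) = G₁,k(U)Q_k*(Q_kG₁,k(U)Q_k*)⁻¹` FROM THE THREE LETTERS OF ROAD
# ΔA-CT, AT EVERY HEIGHT `n`** — the TOWER PORT of `B9Eq3126H1BlockDecayOfLetters`: on `towerP L m (n+1)`, for the assembled `H₁,k(U) = B9Eq326OperatorTower.H1k`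
# (`= G1k ∘ Q_k(U)† ∘ B11Eq103H1Complex.KinvLatticeK` by `rfl`, «`Q_k` onto» discharged there by `QkW_surjective`; any surjectivity witness `hQs` gives the same
# `(Q_kG₁Q_k*)⁻¹` by proof irrelevance): IF `G₁,k(U)` has bond-big-block decay `(C_G, r)` (supplier: `B9Eq326DeltaABlockDecayTower.norm_block_G1k_le`, `C_G = (4∕γ)e^{r}`),
# `Q_k(U)†` has block-to-point decay `(C_Q†, r)` (LOCAL: suppliers `B9Eq315QkLocalLetter` ∕ `B9Eq347LocalLetterAdjoint.block_decay_of_local`, or §2 here from a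
# vanishing-beyond-range letter) and `(Q_kG₁,kQ_k*)⁻¹` has coarse-bond point decay `(C_K, r)` (supplier: `B9Eq3126QG1QInvPointDecayTower.norm_bondPoint_Kinv_le`,
# `C_K = (2∕μ₁)e^{r}`), THEN for every `0 ≤ r′ < r` `‖P_{y₁} ∘ H₁,k(U) ∘ r_{y₀}‖ ≤ C_G·C_Q†·C_K·K_d(r − r′)²·e^{−r′·d_m(y₀,y₁)}` —
# `B9Eq349BlockDecayAlgebra.norm_block_comp3_le_of_decay_torus` at the three factors; the big-block family `P` (`Π = blockCoord (L^{n+1}) m ∘ siteCast ∘ bpos`) and the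
# coarse-bond point family `r` resolve the identity by idempotents (`B9Eq349BlockMultipliers`)

statement-level skeleton of published theorems with citation tags; proofs where landed; nothing here is a claim about the Yang–Mills mass gap

CITATION HEADER (lean-in-tree rule).  Audit cell `pub-balaban`, sub-cell `t4`, BINDER row NE9 (road ΔA-CT of the NE9 formalisation swarm, leaf prover 03
`b2b-balaban-t4-ne9-formalise-leaf-03` gen 76).  Imports `B9Eq326OperatorTower`, `B9Eq316TowerFlatIsOneStep`, `B9Eq349BlockDecayAlgebra` (ne9-leaf-01 g84),
`B9Eq349BlockMultipliers` (ne9-leaf-01), `B9Eq349ConjugatedGreenLetters` (ne9-leaf-06; `norm_adjoint_apply_le'`) — all BUILT.  TEXT = the one-step file with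
`fineP L m ↦ towerP L m (n+1)`, `H1ofU ↦ H1k`, `G1ofU ↦ G1k`, `Q ↦ QkW`, `blockCoord L m ∘ bpos ↦ blockCoord (L^{n+1}) m ∘ siteCast ∘ bpos`.  Sources READ first-hand:
[Balaban1985BackgroundPropagators] p. 393 (3.15)∕(3.16), p. 399 (3.49) (print's `δ₀` NOT asserted), p. 416 Thm 3.11, p. 420 (3.126); [Balaban1985Variational] p. 285 (45),
p. 293 (103), p. 294 (110); [Balaban1984PropagatorsI] p. 38.

WHAT IS PROVED (sorry-free; proof lane — no `def`; [folklore] composition BY NAME), every height `n`.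
* §1 `toCLM_H1k_eq` (`rfl`), `sum_PB_apply` ∕ `PB_idem` (the tower's bond big-block family; the coarse family's identities are the one-step file's
  `sum_rF_apply` ∕ `rF_idem` = `B9Eq349BlockMultipliers` terms, used inline — v1 bounced `dedup.landed` on restating them), **`norm_block_H1k_le_of_letters`**.
* §2 `norm_block_adjointQk_le_of_far` (the `Q_k†` letter from a range `ρ_Q` and `‖Q_k‖ ≤ C_Q`: `(C_Q·e^{rρ_Q}, r)`), **`norm_block_H1k_le_of_far`**.
HONEST SCOPE.  Composition; the three decay letters are DISPLAYED; the rate loss `r′ < r` (load-bearing: `K_d(0) = 0` in the tree's convention) and `K_d(r − r′)²` are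
the algebra's price; no number; NOT NE9 (cell pub-balaban: NE9 NOT PRINTED ∕ NOT PROVED; «NE9 ⇐ the named binders»; row WALLED ON A MODEL (O-NE9-1; #5 UNRULED); spine
PROVED 0∕9; rung (B)+1 on a finite T⁴ — NOT infinite volume, NOT mass gap, NOT BetaPertH, NOT Clay; HONEST DEPENDENCY: continuum YM on T⁴ ⇐ BetaPertH ∧ nine spine
estimates (0/9 proved); BetaPertH ⇐ (D1) ∧ (D4) ∧ CAP+tail).  NEW file; nothing modified.  Net new unproved facts: 0.
-/

noncomputable section

open scoped InnerProductSpace ComplexConjugate BigOperators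

namespace Literature.MathematicalPhysics.QuantumFieldTheory.Balaban1983to89.B9Eq3126H1BlockDecayOfLettersTower

open B4Sect5Torus (TSite tdist)
open B4Sect5Proof (latticeConst)
open B9SectCLatticeCarrier (Bond bpos btgt)
open B9Eq311L2Pairing (WL2)
open B9Eq319QprimeTorus (fineP blockCoord)
open B11Eq103H1Complex (SiteL2K BondL2K KinvLatticeK H1LatticeK_eq)
open B9Eq310HessianOperator (adTransportW)
open B9Eq315QTower (towerP)
open B9Eq315QTorus (perCfg cornerSite)
open B7Prop1Explicit (Wcx boxVec U1)
open B9Eq316TowerFlatIsOneStep (siteCast towerP_eq_fineP_pow)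
open B9Eq326OperatorTower (laplaceAk G1k H1k QkW)
open B9Eq349BlockDecayAlgebra (norm_block_comp3_le_of_decay_torus decay_of_local)
open B9Eq349BlockMultipliers (sum_block_apply block_comp_self opNorm_block_le)
open B9Eq349ConjugatedGreenLetters (norm_adjoint_apply_le')

variable {d : ℕ} {L : ℕ} [NeZero L] {m : Fin d → ℕ} [∀ i, NeZero (m i)] {n : ℕ} {𝔸 : Type*} [NormedRing 𝔸] [StarRing 𝔸] [NormedAlgebra ℂ 𝔸] [StarModule ℂ 𝔸]
  [CompleteSpace 𝔸] [NormOneClass 𝔸]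
  {W : Type*} [NormedAddCommGroup W] [InnerProductSpace ℂ W] [FiniteDimensional ℂ W] (φ : W ≃ₗ[ℂ] 𝔸)
  {c₀ c₁ : ℝ} [Fact (0 < c₀)] [Fact (0 < c₁)] (η : ℝ) (U : Bond d (towerP L m (n + 1)) → 𝔸ˣ) (τ : 𝔸 →ₗ[ℂ] ℂ) (hL : 1 ≤ L) (α : ℕ → ℝ) (hα1 : ∀ j, α j ≤ 1 / 64)
  (hU1 : ∀ (j : ℕ) (x : B7Prop1Explicit.Site d) (κ : Fin d), perCfg (towerP L m (j + 1)) (B9Eq315QTower.UlevOf L m (n + 1) U j) x κ ∈ U1 𝔸)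
  (hreg : ∀ (j : ℕ) (y : TSite d (towerP L m j)) (κ : Fin d) (r : Fin d → Fin L),
    ‖((Wcx L (perCfg (towerP L m (j + 1)) (B9Eq315QTower.UlevOf L m (n + 1) U j)) (cornerSite L y) κ (boxVec L r) : 𝔸ˣ) : 𝔸) - 1‖ ≤ α j)
  {a : ℝ} (hαL : ∀ j, 50 * (d + 1) * α j * (L : ℝ) ^ d ≤ 1 / 2)
  (hpos : ∀ x : BondL2K ℂ d (towerP L m (n + 1)) c₀ W, x ≠ 0 → 0 < RCLike.re ⟪x, laplaceAk L m n φ η U hL α hα1 hU1 hreg τ (c₀ := c₀) (c₁ := c₁) a x⟫_ℂ)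
  (hQs : Function.Surjective (QkW L m n φ U hL α hα1 hU1 hreg (c₀ := c₀) (c₁ := c₁)))
  {PB : TSite d m → BondL2K ℂ d (towerP L m (n + 1)) c₀ W →L[ℂ] BondL2K ℂ d (towerP L m (n + 1)) c₀ W}
  (hPB : ∀ (y : TSite d m) (f : BondL2K ℂ d (towerP L m (n + 1)) c₀ W) (b : Bond d (towerP L m (n + 1))),
    WL2.equiv ℂ (fun _ : Bond d (towerP L m (n + 1)) => c₀) W (PB y f) b =
      if blockCoord (L ^ (n + 1)) m (siteCast (towerP_eq_fineP_pow L m (n + 1)) (bpos b)) = y then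
        WL2.equiv ℂ (fun _ : Bond d (towerP L m (n + 1)) => c₀) W f b else 0)
  {rF : TSite d m → BondL2K ℂ d m c₁ W →L[ℂ] BondL2K ℂ d m c₁ W}
  (hrF : ∀ (y : TSite d m) (g : BondL2K ℂ d m c₁ W) (b' : Bond d m),
    WL2.equiv ℂ (fun _ : Bond d m => c₁) W (rF y g) b' = if bpos b' = y then WL2.equiv ℂ (fun _ : Bond d m => c₁) W g b' else 0)

/-! ## §1 `H₁,k = G₁,k ∘ Q_k† ∘ (Q_kG₁,kQ_k*)⁻¹` and the END from the three decay letters, every height -/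

/-- `H₁,k(U) = G₁,k(U) ∘ Q_k† ∘ (Q_kG₁,kQ_k*)⁻¹` as continuous linear maps, for ANY surjectivity witness `hQs` of `Q_k` (`B11Eq103H1Complex.H1LatticeK_eq`, `rfl`;
the witness inside `H1k` is `QkW_surjective … hαL`, proof-irrelevant).
[cite: Balaban1985Variational, (103) p.293, (45) p.285] -/
theorem toCLM_H1k_eq :
    LinearMap.toContinuousLinearMap (H1k L m n φ η U hL α hα1 hU1 hreg τ hαL hpos) =
      LinearMap.toContinuousLinearMap (G1k L m n φ η U hL α hα1 hU1 hreg τ (c₀ := c₀) (c₁ := c₁) hpos) ∘L LinearMap.toContinuousLinearMap (LinearMap.adjoint (QkW L m n φ U hL α hα1 hU1 hreg (c₀ := c₀) (c₁ := c₁))) ∘L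
        LinearMap.toContinuousLinearMap (KinvLatticeK hpos hQs) :=
  ContinuousLinearMap.ext fun _ => rfl

omit [NeZero L] [∀ i, NeZero (m i)] [FiniteDimensional ℂ W] in
include hPB in
/-- the bond big-block family of the tower resolves the identity: `Σ_y P_y f = f` on `L²(Bond (towerP L m (n+1)))`. [folklore] [cite: Balaban1985BackgroundPropagators, (3.49) p.399] -/
theorem sum_PB_apply (f : BondL2K ℂ d (towerP L m (n + 1)) c₀ W) : ∑ y, PB y f = f :=
  sum_block_apply (π := fun b : Bond d (towerP L m (n + 1)) => blockCoord (L ^ (n + 1)) m (siteCast (towerP_eq_fineP_pow L m (n + 1)) (bpos b))) hPB f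

omit [NeZero L] [∀ i, NeZero (m i)] [FiniteDimensional ℂ W] in
include hPB in
/-- `P_y ∘ P_y = P_y` for the tower's bond big-block family (typed on `towerP L m (n+1)`). [folklore] [cite: Balaban1985BackgroundPropagators, (3.49) p.399] -/
theorem PB_idem (y : TSite d m) : (PB y ∘L PB y : BondL2K ℂ d (towerP L m (n + 1)) c₀ W →L[ℂ] BondL2K ℂ d (towerP L m (n + 1)) c₀ W) = PB y :=
  block_comp_self (π := fun b : Bond d (towerP L m (n + 1)) => blockCoord (L ^ (n + 1)) m (siteCast (towerP_eq_fineP_pow L m (n + 1)) (bpos b))) hPB y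

include hPB hrF in
/-- **THE `L²` DECAY OF `H₁,k(U)` FROM THE THREE LETTERS, EVERY HEIGHT `n`**: `G₁,k(U)` with bond-big-block decay `(C_G, r)`, `Q†` with block-to-point decay `(C_Q†, r)`, `(QG₁(U)Q*)⁻¹`
with coarse-bond point decay `(C_K, r)`, `0 ≤ r′ < r` ⟹ `‖P_{y₁} ∘ H₁,k(U) ∘ r_{y₀}‖ ≤ C_G·C_Q†·C_K·K_d(r − r′)²·e^{−r′·d_m(y₀,y₁)}` — uniform in the volume `m`.
[folklore] (composition) [cite: Balaban1985BackgroundPropagators, (3.49) p.399, (3.126) p.420, Thm 3.11 p.416; Balaban1985Variational, (45) p.285, (103) p.293;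
Balaban1984PropagatorsI, p.38] -/
theorem norm_block_H1k_le_of_letters (hm : ∀ i, 1 ≤ m i) {CG CQa CK r r' : ℝ} (hCG : 0 ≤ CG) (hCQa : 0 ≤ CQa) (hCK : 0 ≤ CK)
    (hr' : 0 ≤ r') (hr'r : r' < r)
    (hG : ∀ z y₁, ‖PB y₁ ∘L LinearMap.toContinuousLinearMap (G1k L m n φ η U hL α hα1 hU1 hreg τ (c₀ := c₀) (c₁ := c₁) hpos) ∘L PB z‖ ≤ CG * Real.exp (-(r * tdist m z y₁)))
    (hQa : ∀ z z', ‖PB z' ∘L LinearMap.toContinuousLinearMap (LinearMap.adjoint (QkW L m n φ U hL α hα1 hU1 hreg (c₀ := c₀) (c₁ := c₁))) ∘L rF z‖ ≤ CQa * Real.exp (-(r * tdist m z z')))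
    (hK : ∀ y₀ z, ‖rF z ∘L LinearMap.toContinuousLinearMap (KinvLatticeK hpos hQs) ∘L rF y₀‖ ≤ CK * Real.exp (-(r * tdist m y₀ z)))
    (y₀ y₁ : TSite d m) :
    ‖PB y₁ ∘L LinearMap.toContinuousLinearMap (H1k L m n φ η U hL α hα1 hU1 hreg τ hαL hpos) ∘L rF y₀‖ ≤
      CG * CQa * CK * latticeConst d (r - r') ^ 2 * Real.exp (-(r' * tdist m y₀ y₁)) := by
  -- the coarse family's identities are `B9Eq349BlockMultipliers` terms at `π := bpos` (= the one-step file's `sum_rF_apply` ∕ `rF_idem`, not restated)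
  have hsum : ∀ g : BondL2K ℂ d m c₁ W, ∑ y, rF y g = g := fun g => sum_block_apply (π := fun b' : Bond d m => bpos b') hrF g
  have hidem : ∀ y : TSite d m, rF y ∘L rF y = rF y := fun y => block_comp_self (π := fun b' : Bond d m => bpos b') hrF y
  have h := norm_block_comp3_le_of_decay_torus hm rF hsum hidem PB (sum_PB_apply hPB) (PB_idem hPB)
    (LinearMap.toContinuousLinearMap (G1k L m n φ η U hL α hα1 hU1 hreg τ (c₀ := c₀) (c₁ := c₁) hpos)) (LinearMap.toContinuousLinearMap (LinearMap.adjoint (QkW L m n φ U hL α hα1 hU1 hreg (c₀ := c₀) (c₁ := c₁))))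
    (LinearMap.toContinuousLinearMap (KinvLatticeK hpos hQs)) PB rF hCG hCQa hCK hr' hr'r hG hQa hK y₀ y₁
  rw [toCLM_H1k_eq φ η U τ hL α hα1 hU1 hreg hαL hpos hQs]
  exact h

/-! ## §2 The `Q†` letter from a vanishing-beyond-range letter -/

omit [StarRing 𝔸] [StarModule ℂ 𝔸] in
include hPB hrF in
/-- **THE `Q†` LETTER OF A LOCAL AVERAGING**: if `P_{z′} ∘ Q† ∘ r_z = 0` whenever `d_m(z, z′) > ρ_Q` and `‖Qf‖ ≤ C_Q‖f‖`, then for every `r ≥ 0`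
`‖P_{z′} ∘ Q† ∘ r_z‖ ≤ C_Q·e^{rρ_Q}·e^{−r·d_m(z,z′)}` (`‖Q†‖ = ‖Q‖`, `‖P_{z′}‖, ‖r_z‖ ≤ 1`, `B9Eq349BlockDecayAlgebra.decay_of_local`). [folklore]
[cite: Balaban1985BackgroundPropagators, (3.15) p.393, (3.42) p.397, (3.49) p.399] -/
theorem norm_block_adjointQk_le_of_far {CQ ρQ r : ℝ} (hCQ : 0 ≤ CQ) (hr : 0 ≤ r) (hQ : ∀ f, ‖(QkW L m n φ U hL α hα1 hU1 hreg (c₀ := c₀) (c₁ := c₁)) f‖ ≤ CQ * ‖f‖)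
    (hfar : ∀ z z', ρQ < tdist m z z' → PB z' ∘L LinearMap.toContinuousLinearMap (LinearMap.adjoint (QkW L m n φ U hL α hα1 hU1 hreg (c₀ := c₀) (c₁ := c₁))) ∘L rF z = 0) (z z' : TSite d m) :
    ‖PB z' ∘L LinearMap.toContinuousLinearMap (LinearMap.adjoint (QkW L m n φ U hL α hα1 hU1 hreg (c₀ := c₀) (c₁ := c₁))) ∘L rF z‖ ≤ CQ * Real.exp (r * ρQ) * Real.exp (-(r * tdist m z z')) := by
  have hQan : ‖LinearMap.toContinuousLinearMap (LinearMap.adjoint (QkW L m n φ U hL α hα1 hU1 hreg (c₀ := c₀) (c₁ := c₁)))‖ ≤ CQ :=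
    ContinuousLinearMap.opNorm_le_bound _ hCQ fun g => norm_adjoint_apply_le' (QkW L m n φ U hL α hα1 hU1 hreg (c₀ := c₀) (c₁ := c₁)) hCQ hQ g
  have hnear : ∀ z z' : TSite d m, ‖PB z' ∘L LinearMap.toContinuousLinearMap (LinearMap.adjoint (QkW L m n φ U hL α hα1 hU1 hreg (c₀ := c₀) (c₁ := c₁))) ∘L rF z‖ ≤ CQ := fun z z' => by
    have h1 : ‖PB z' ∘L LinearMap.toContinuousLinearMap (LinearMap.adjoint (QkW L m n φ U hL α hα1 hU1 hreg (c₀ := c₀) (c₁ := c₁))) ∘L rF z‖ ≤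
        ‖PB z'‖ * (‖LinearMap.toContinuousLinearMap (LinearMap.adjoint (QkW L m n φ U hL α hα1 hU1 hreg (c₀ := c₀) (c₁ := c₁)))‖ * ‖rF z‖) :=
      (ContinuousLinearMap.opNorm_comp_le _ _).trans
        (mul_le_mul_of_nonneg_left (ContinuousLinearMap.opNorm_comp_le _ _) (norm_nonneg _))
    have h2 : ‖PB z'‖ * (‖LinearMap.toContinuousLinearMap (LinearMap.adjoint (QkW L m n φ U hL α hα1 hU1 hreg (c₀ := c₀) (c₁ := c₁)))‖ * ‖rF z‖) ≤ 1 * (CQ * 1) :=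
      mul_le_mul (opNorm_block_le hPB z') (mul_le_mul hQan (opNorm_block_le hrF z) (norm_nonneg _) hCQ)
        (mul_nonneg (norm_nonneg _) (norm_nonneg _)) zero_le_one
    linarith
  exact decay_of_local (δ := tdist m) (LinearMap.toContinuousLinearMap (LinearMap.adjoint (QkW L m n φ U hL α hα1 hU1 hreg (c₀ := c₀) (c₁ := c₁)))) PB rF hCQ hr hfar (fun z z' _ => hnear z z') z z'

include hPB hrF in
/-- **THE `L²` DECAY OF `H₁,k(U)`, `Q_k†` LETTER IN PRIMITIVE FORM**: as `norm_block_H1k_le_of_letters` with the `Q†` letter supplied by §2 from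
`‖Q_k‖ ≤ C_Q` and the range `ρ_Q`: `‖P_{y₁} ∘ H₁,k(U) ∘ r_{y₀}‖ ≤ C_G·(C_Q e^{rρ_Q})·C_K·K_d(r − r′)²·e^{−r′·d_m(y₀,y₁)}`. [folklore] (composition)
[cite: Balaban1985BackgroundPropagators, (3.49) p.399, (3.126) p.420, Thm 3.11 p.416; Balaban1985Variational, (45) p.285, (103) p.293; Balaban1984PropagatorsI, p.38] -/
theorem norm_block_H1k_le_of_far (hm : ∀ i, 1 ≤ m i) {CG CQ CK ρQ r r' : ℝ} (hCG : 0 ≤ CG) (hCQ : 0 ≤ CQ) (hCK : 0 ≤ CK)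
    (hr' : 0 ≤ r') (hr'r : r' < r) (hQ : ∀ f, ‖(QkW L m n φ U hL α hα1 hU1 hreg (c₀ := c₀) (c₁ := c₁)) f‖ ≤ CQ * ‖f‖)
    (hfar : ∀ z z', ρQ < tdist m z z' → PB z' ∘L LinearMap.toContinuousLinearMap (LinearMap.adjoint (QkW L m n φ U hL α hα1 hU1 hreg (c₀ := c₀) (c₁ := c₁))) ∘L rF z = 0)
    (hG : ∀ z y₁, ‖PB y₁ ∘L LinearMap.toContinuousLinearMap (G1k L m n φ η U hL α hα1 hU1 hreg τ (c₀ := c₀) (c₁ := c₁) hpos) ∘L PB z‖ ≤ CG * Real.exp (-(r * tdist m z y₁)))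
    (hK : ∀ y₀ z, ‖rF z ∘L LinearMap.toContinuousLinearMap (KinvLatticeK hpos hQs) ∘L rF y₀‖ ≤ CK * Real.exp (-(r * tdist m y₀ z)))
    (y₀ y₁ : TSite d m) :
    ‖PB y₁ ∘L LinearMap.toContinuousLinearMap (H1k L m n φ η U hL α hα1 hU1 hreg τ hαL hpos) ∘L rF y₀‖ ≤
      CG * (CQ * Real.exp (r * ρQ)) * CK * latticeConst d (r - r') ^ 2 * Real.exp (-(r' * tdist m y₀ y₁)) :=
  norm_block_H1k_le_of_letters φ η U τ hL α hα1 hU1 hreg hαL hpos hQs hPB hrF hm hCG (by positivity) hCK hr' hr'r hG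
    (norm_block_adjointQk_le_of_far φ U hL α hα1 hU1 hreg hPB hrF hCQ (hr'.trans hr'r.le) hQ hfar) hK y₀ y₁

end Literature.MathematicalPhysics.QuantumFieldTheory.Balaban1983to89.B9Eq3126H1BlockDecayOfLettersTower

end
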